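import Summits.NavierStokesRegularity.NavierStokesRegularity.Theses.PerpetualPump
import Literature.Analysis.FluidPDE.TaoAveragedSobolevSymmetry

/-!
# Crux `AveragedTypeIBlowup` (stmt-NavierStokesRegularity-1835), negative side: the symmetry hypothesis is redundant

Negative-side (cdisprove, D-0016) support lemmas extracted from
`Cruxes/AveragedTypeIBlowup/Disproof.lean` (v2, §4b). Hypothesis-mutation finding: the conjunct
`𝒜.IsSymmetric` of the crux (and of the route target `Thesis`) is LOGICALLY REDUNDANT — the
averaged Navier–Stokes equation `∂ₜu = Δu + B̃(u,u)` only sees the quadratic form `u ↦ B̃(u,u)`,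
and the symmetrisation `𝒜.symmetrize` (accepted, `TaoAveragedSobolevSymmetry.lean`: sample space
`Ω × Bool`, slots 1 and 2 exchanged on heads) has the same quadratic form, is symmetric and keeps
the cancellation property (1.16).

* `symmetrize_form_diag` — `⟨B̃ˢʸᵐ(u,u), w⟩ = ⟨B̃(u,u), w⟩` for all `u, w` (unconditional; extends
  the accepted `symmetrize_form_self`, which is the case `w = u`);
* `isMildSolution_symmetrize_iff` — `𝒜.symmetrize` and `𝒜` have the same mild solutions (1.15);
* `averagedTypeIBlowup_iff_noSymm` — the crux is equivalent to its version over ALL averaging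
  data with cancellation (symmetry dropped);
* `thesis_noSymm` — dually, `Thesis` already gives Type-I exclusion for all data with
  cancellation.

Consequence for provers of the crux: the symmetry of the witness datum need not be arranged (Tao's
Theorem 3.2 data happen to be symmetric anyway); for would-be disprovers: nothing is gained from
symmetry. Nothing here closes the item (`--supports`); no statement of the route is changed.

## References

* T. Tao, J. Amer. Math. Soc. 29 (2016), arXiv:1402.0290v3, §1.1 (1.13), (1.15), (1.16),
  Remark 1.6 (symmetrisation `T = ½(T₁₂ + T₂₁)`), Thm. 1.5. [`Tao2016AveragedNS`]
-/

noncomputable section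

namespace Summit.NavierStokesRegularity.NavierStokesRegularity.Theorems.AveragedTypeIBlowup.Negative

open MeasureTheory Set Filter Topology
open scoped ENNReal
open Literature.Analysis.FluidPDE Literature.Analysis.FluidPDE.Tao2016
open Literature.Analysis.FluidPDE.Tao2016.AveragingDatum
open Summit.NavierStokesRegularity.NavierStokesRegularity.Theses.PerpetualPump

/-- **On the partial diagonal the symmetrisation changes nothing**:
`⟨B̃ˢʸᵐ(u,u), w⟩ = ⟨B̃(u,u), w⟩` for ALL `u, w ∈ L²` (unconditionally, no integrability needed:
on heads the integrand is `⟨B(A₂u, A₁u), A₃w⟩ = ⟨B(A₁u, A₂u), A₃w⟩` pointwise in `θ`, by the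
symmetry of the Euler form `eulerForm_symm`). [folklore] -/
theorem symmetrize_form_diag (𝒜 : AveragingDatum) (u w : L2C) :
    𝒜.symmetrize.form u u w = 𝒜.form u u w := by
  have key : ∀ p : 𝒜.Ω × Bool,
      eulerForm (𝒜.symmetrize.slot 0 p u) (𝒜.symmetrize.slot 1 p u) (𝒜.symmetrize.slot 2 p w) =
      eulerForm (𝒜.slot 0 p.1 u) (𝒜.slot 1 p.1 u) (𝒜.slot 2 p.1 w) := by
    rintro ⟨θ, b⟩
    cases b
    · rfl
    · simp only [symmetrize_slot, swapSlot_true_zero, swapSlot_true_one, swapSlot_true_two]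
      exact eulerForm_symm _ _ _
  have h : ∫ p, eulerForm (𝒜.symmetrize.slot 0 p u) (𝒜.symmetrize.slot 1 p u)
      (𝒜.symmetrize.slot 2 p w) ∂𝒜.coinMeasure =
      ∫ p, eulerForm (𝒜.slot 0 p.1 u) (𝒜.slot 1 p.1 u) (𝒜.slot 2 p.1 w) ∂𝒜.coinMeasure :=
    integral_congr_ae (Eventually.of_forall key)
  exact h.trans (𝒜.integral_coinMeasure_comp_fst
    fun θ => eulerForm (𝒜.slot 0 θ u) (𝒜.slot 1 θ u) (𝒜.slot 2 θ w))

/-- **The averaged equation only sees the quadratic form**: `u` is a mild solution for the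
symmetrised datum iff it is one for `𝒜` (the Duhamel identity (1.15) involves `⟨B̃(u(s),u(s)), ·⟩`
only). [folklore] -/
theorem isMildSolution_symmetrize_iff (𝒜 : AveragingDatum) (a : L2C) (I : Set ℝ) (u : ℝ → L2C) :
    𝒜.symmetrize.IsMildSolution a I u ↔ 𝒜.IsMildSolution a I u := by
  unfold AveragingDatum.IsMildSolution IsMildSolutionFor
  simp only [symmetrize_form_diag]

/-- **`IsSymmetric` is logically redundant in the crux**: a Type-I blow-up for ANY averaging
datum with cancellation yields one for a SYMMETRIC datum with cancellation — its symmetrisation,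
which has the same mild solutions (`isMildSolution_symmetrize_iff`), is symmetric
(`symmetrize_isSymmetric`) and keeps (1.16) (`symmetrize_hasCancellation_iff`). [folklore] -/
theorem averagedTypeIBlowup_iff_noSymm :
    AveragedTypeIBlowup ↔
    (∃ 𝒜 : AveragingDatum, 𝒜.HasCancellation ∧
      ∃ u₀ : SchwartzMap (EuclideanSpace ℝ (Fin 3)) (EuclideanSpace ℝ (Fin 3)),
        VectorCalculus.IsDivFree ⇑u₀ ∧ ∃ T : ℝ, 0 < T ∧ ∃ u : ℝ → L2C,
        𝒜.IsMildSolution (schwartzL2 u₀) (Ico 0 T) u ∧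
        (∃ M : ℝ, ∀ t ∈ Ico 0 T, eLpNorm (u t) ⊤ volume ≤ ENNReal.ofReal (M / Real.sqrt (T - t))) ∧
        ¬ ∃ T' : ℝ, T < T' ∧ ∃ v : ℝ → L2C,
          𝒜.IsMildSolution (schwartzL2 u₀) (Ico 0 T') v ∧ ∀ t ∈ Ico 0 T, v t = u t) := by
  constructor
  · rintro ⟨𝒜, -, hc, u₀, hdiv, T, hT, u, hmild, hrate, hno⟩
    exact ⟨𝒜, hc, u₀, hdiv, T, hT, u, hmild, hrate, hno⟩
  · rintro ⟨𝒜, hc, u₀, hdiv, T, hT, u, hmild, hrate, hno⟩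
    refine ⟨𝒜.symmetrize, 𝒜.symmetrize_isSymmetric, 𝒜.symmetrize_hasCancellation_iff.mpr hc,
      u₀, hdiv, T, hT, u, (isMildSolution_symmetrize_iff 𝒜 _ _ _).mpr hmild, hrate, ?_⟩
    rintro ⟨T', hTT', v, hv, hvu⟩
    exact hno ⟨T', hTT', v, (isMildSolution_symmetrize_iff 𝒜 _ _ _).mp hv, hvu⟩

/-- Dually, the route target `Thesis` (abstract Type-I exclusion for symmetric data with
cancellation) already implies Type-I exclusion for ALL data with cancellation. [folklore] -/
theorem thesis_noSymm (h : Thesis) (𝒜 : AveragingDatum) (hc : 𝒜.HasCancellation)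
    (u₀ : SchwartzMap (EuclideanSpace ℝ (Fin 3)) (EuclideanSpace ℝ (Fin 3)))
    (hdiv : VectorCalculus.IsDivFree ⇑u₀) (T : ℝ) (hT : 0 < T) (u : ℝ → L2C)
    (hmild : 𝒜.IsMildSolution (schwartzL2 u₀) (Ico 0 T) u)
    (hrate : ∃ M : ℝ, ∀ t ∈ Ico 0 T, eLpNorm (u t) ⊤ volume ≤ ENNReal.ofReal (M / Real.sqrt (T - t))) :
    ∃ T' : ℝ, T < T' ∧ ∃ v : ℝ → L2C,
      𝒜.IsMildSolution (schwartzL2 u₀) (Ico 0 T') v ∧ ∀ t ∈ Ico 0 T, v t = u t := by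
  obtain ⟨T', hTT', v, hv, hvu⟩ := h 𝒜.symmetrize 𝒜.symmetrize_isSymmetric
    (𝒜.symmetrize_hasCancellation_iff.mpr hc) u₀ hdiv T hT u
    ((isMildSolution_symmetrize_iff 𝒜 _ _ _).mpr hmild) hrate
  exact ⟨T', hTT', v, (isMildSolution_symmetrize_iff 𝒜 _ _ _).mp hv, hvu⟩

end Summit.NavierStokesRegularity.NavierStokesRegularity.Theorems.AveragedTypeIBlowup.Negative

end
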